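import Summits.BirchSwinnertonDyer.BirchSwinnertonDyer.Theorems.ClassRecordThreeCartanSupplyHeckeCut
import Summits.BirchSwinnertonDyer.BirchSwinnertonDyer.Theorems.ClassRecordThreeCartanSupplyDoubleCosetOperator
import HarnessLib

/-!
# Dockings under the double-coset operator `𝒯♭` — §I.3 of the `doublecoset` certificate for crux 24801 `CartanOnePlaceDegreeLawAtThree`

Lift-only port (cell bsd-stepL, SUMMON key `k5-lift1`, director-bsd (734)(1) CONCUR 2026-08-31) of §I.3 (source lines 2312–2569) of the crux-ideate workfile
`Summits/BirchSwinnertonDyer/BirchSwinnertonDyer/Cruxes/CartanOnePlaceDegreeLawAtThree/Lines/doublecoset.lean` (lineage `cruxidea-stmt-BirchSwinnertonDyer-24801-1`, generation 22,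
commit 721e9ccbdf4b, sha256-16 d3adee7328f6a76c, 2876 l.; farm rc 0, sorries 4 = its §4 stubs, none of which is lifted; referee landing record `VERDICT-DOUBLECOSET-G22-g88.md`).
Declarations, statements and proofs below are BYTE-IDENTICAL to the source; the only edits are the namespace (`…Cruxes.CartanOnePlaceDegreeLawAtThree.Doublecoset` ↦
`…Theorems.CartanDoubleCoset`, shared by the nine `ClassRecordThreeCartanSupply*` modules), the imports ∕ `open`s each module needs, and one-line docstrings added where the source
had none. Nothing is re-stated, weakened or re-proved.

CONTENT (generation 22, real proofs). (A′) the value at `1` decides (`SimRep.heckeLin_dockTorus_of_one`: translation (T1) + `T`-invariance + equivariance (T2)).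
(HF)(ii)♭ the NON-SPLIT DOCKING of an `X.heckeFun ℓ`-eigenform is a `𝒯♭`-eigenvector with the same eigenvalue (`SimRep.heckeLin_dockNonsplit`: `c_i ∈ T_η`,
`g_i ∈ X.Gamma`, off the coset by the normality trick). THE SPLIT SIDE: `O_s ⊆ O₀'`, `ι(O_s¹) ≤ ι(O₀'¹)`, `ι(O_s¹) ≤ Γ_{T_s}`; the strong-approximation witnesses
`γ_i` (`SimRep.wit`, from `mem_torusCoset_split`), `δ_i := γ_i⁻¹ α_i ∈ ι(O_s(ℓ))` (K1 `δ_mem`), pairwise `ι(O_s¹)`-inequivalent (K2 `δ_inj`), meeting every coset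
(K3 `δ_cover`), so `i ↦ [δ_i]` is a bijection `Γ∖ι(O(ℓ)) → ι(O_s¹)∖ι(O_s(ℓ))` (`toUnitsQuot_bijective`); THE KEY IDENTITY (HF)(iii)♭
`(𝒯♭ (dockTorus T_s F))(1) = T_ℓ^{O_s} F` (`heckeFn_dockTorus_split_one`) and the iff-docking `heckeLin_dockTorus_split_iff`.

HONEST: a `--supports stmt-BirchSwinnertonDyer-24801` helper module; it proves NOTHING about NUM ∕ NUM♮ (items 24801 ∕ 32276) or crux 19109 for any curve — the leaves (MO1)
`SplitLevelMultiplicityOne`, (BCV) `BorelCubicEigenDocking`, (VAN) `NonsplitTorusCubicVanishing`, (DS) ∧ (JLᶜ) stay OPEN; registry `Lines/petarea.lean` rev 8 untouched; BSD is proved for no curve.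
-/

set_option linter.dupNamespace false  -- `Summit.BirchSwinnertonDyer.BirchSwinnertonDyer.…` (summit = problem), as every file of this directory
set_option autoImplicit false

noncomputable section

open scoped Classical MatrixGroups
open Matrix

namespace Summit.BirchSwinnertonDyer.BirchSwinnertonDyer.Theorems.CartanDoubleCoset

open Summit.BirchSwinnertonDyer.BirchSwinnertonDyer.Theorems
open Summit.BirchSwinnertonDyer.BirchSwinnertonDyer.Theorems.CartanDegree (HasRatEigenvalue)
open Summit.BirchSwinnertonDyer.BirchSwinnertonDyer.Theorems.CartanTorusCubeCut (torusSubgroup mem_torusSubgroup lin linGL linGL_coe lin_comm torusSubgroup_isCyclic card_torusSubgroup)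
open Summit.BirchSwinnertonDyer.BirchSwinnertonDyer.Theorems.CartanCover (splitGen mem_splitTorus_iff)
open Summit.BirchSwinnertonDyer.BirchSwinnertonDyer.Theorems.CartanCover.Charext.InertHecke (upperUnip lowerUnip coe_upperUnip coe_lowerUnip upperUnip_mul upperUnip_zero exists_unip_factorization)
open scoped Pointwise ModularForm NumberField
open Module UpperHalfPlane
open Literature.NumberTheory.Automorphic WeierstrassCurve Literature.NumberTheory.EllipticCurves Literature.NumberTheory.EllipticCurves.ModularForms
open Literature.NumberTheory.EllipticCurves.Rank1Residual Summit.BirchSwinnertonDyer.Rank1Residual Literature.NumberTheory.GaloisRepresentations NumberField IsDedekindDomain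
open Summit.BirchSwinnertonDyer.BirchSwinnertonDyer.Theorems.CartanCover
open Summit.BirchSwinnertonDyer.BirchSwinnertonDyer.Theorems.CartanCover.CMRank
open Summit.BirchSwinnertonDyer.BirchSwinnertonDyer.Theorems.CartanTorusCubeCut
open Summit.BirchSwinnertonDyer.BirchSwinnertonDyer.Theorems.CartanDegree (cubicNewvectorChar HasRatEigenvalue)

section HeckeCut

variable {D M : ℕ} {C : Finset ℕ} {X : CartanLevelCurveData D M C} {q : ℕ} [Fact q.Prime]

/-! ### §I.3 Dockings under `𝒯♭`: the value at `1` decides (FIX + equivariance), the non-split docking ((HF)(ii)), the split docking ((HF)(iii)) -/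

namespace SimRep

variable {ℓ : ℕ} (S : SimRep X q ℓ) (R : CoverReduction X q) [Fintype (Quotient (X.heckeSetoid ℓ))]

/-- **A′: the value at `1` decides.** For a torus docking `w = dockTorus T F`: if `(𝒯♭ w)(1) = a·F` and `𝒯♭ w` vanishes off the double coset
`redHom(ι(O₀'¹))·T`, then `𝒯♭ w = a · w` component-wise (translation (T1), `T`-invariance of `w`, equivariance (T2)). -/
theorem heckeLin_dockTorus_of_one (T : Subgroup (GL (Fin 2) (ZMod q))) (F : CuspForm (R.levelOf T) 2) (a : ℂ)
    (h1 : S.heckeFn R (R.dockTorus T F) 1 = a • ⇑F)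
    (hoff : ∀ gb, gb ∉ R.torusCoset T → S.heckeFn R (R.dockTorus T F) gb = 0) :
    S.heckeLin R (R.dockTorus T F) = a • coeLin R (R.dockTorus T F) := by
  funext gb
  rw [heckeLin_apply, Pi.smul_apply, coeLin_apply]
  by_cases hg : gb ∈ R.torusCoset T
  · obtain ⟨γ, hγ⟩ := hg
    have hval : ⇑((R.dockTorus T F).1 gb) = ⇑F ∣[(2 : ℤ)] ((γ : GL (Fin 2) ℝ)⁻¹) := by
      rw [R.dockTorus_apply_of_witness T F hγ, coverRep_apply, coe_coverSlash, CoverReduction.coe_restrictLevel]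
    have hT : S.heckeFn R (R.dockTorus T F) ((R.redHom γ)⁻¹ * gb) = a • ⇑F := by
      rw [← one_mul ((R.redHom γ)⁻¹ * gb), S.heckeFn_mul R, R.indRep_dockTorus_of_mem T F hγ, h1]
    have e : gb = R.redHom γ * ((R.redHom γ)⁻¹ * gb) := (mul_inv_cancel_left _ _).symm
    rw [hval]
    conv_lhs => rw [e]
    rw [S.heckeFn_redHom_mul R, hT, smul_slash_of_det_pos _ _ (det_inv_pos γ)]
  · rw [hoff gb hg, R.dockTorus_apply_of_not T F hg, CuspForm.coe_zero, smul_zero]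

/-- **(HF)(ii) DISCHARGED**: the non-split docking of an `X.heckeFun ℓ`-eigenform is a `𝒯♭`-eigenvector with the same eigenvalue
(`c_i ∈ T_η`, `g_i ∈ X.Gamma`, `Σ_i F ∣ α_i = Σ_i F ∣ i.out = T_ℓ F`; off the coset by the normality trick). -/
theorem heckeLin_dockNonsplit (hq : q ∈ C) (F : CuspForm X.Gamma 2) (a : ℂ) (hF : X.heckeFun ℓ F = fun τ => a * F τ) :
    S.heckeLin R (R.dockNonsplit hq F) = a • coeLin R (R.dockNonsplit hq F) := by
  rw [← R.dockTorus_torus_eq_dockNonsplit hq F]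
  apply S.heckeLin_dockTorus_of_one R
  · rw [heckeFn_def]
    have hterm : ∀ i : Quotient (X.heckeSetoid ℓ),
        ⇑((R.dockTorus (torusSubgroup R.η) (R.ofGammaForm F)).1 (S.c R i * 1)) ∣[(2 : ℤ)] (S.α i)
          = ⇑F ∣[(2 : ℤ)] ((i.out : X.heckeSet ℓ) : GL (Fin 2) ℝ) := by
      intro i
      have hw : (R.redHom 1)⁻¹ * (S.c R i * 1) ∈ torusSubgroup R.η := by
        rw [map_one, inv_one, one_mul, mul_one]; exact S.c_mem_torus R i
      rw [R.dockTorus_apply_of_witness _ _ hw, map_one, Module.End.one_apply, CoverReduction.coe_restrictLevel,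
        CoverReduction.coe_ofGammaForm, α_def, SlashAction.slash_mul, SlashInvariantForm.slash_action_eqn F _ (S.g_mem i)]
    simp_rw [hterm]
    funext τ
    rw [Finset.sum_apply, Pi.smul_apply, ← finsum_eq_sum_of_fintype, smul_eq_mul]
    exact congr_fun hF τ
  · intro gb hgb
    rw [heckeFn_def]
    apply Finset.sum_eq_zero
    intro i _
    have hi : S.c R i * gb ∉ R.torusCoset (torusSubgroup R.η) :=
      fun h => hgb (mem_torusCoset_of_mul_mem R hq (S.c_mem_torus R i) h)
    rw [R.dockTorus_apply_of_not _ _ hi, CuspForm.coe_zero, SlashAction.zero_slash]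

/-! #### The split side: `(𝒯♭ (dockTorus T_s F))(1) = T_ℓ^{O_s} F` -/

section Split

variable (hq : q ∈ C) (Os : Submodule ℤ X.B) (hOs : Brandt.IsOrder X.B Os)
  (hpres : ∀ m : Matrix (Fin 2) (Fin 2) ℝ, (∃ x ∈ Os, X.ι x = m) ↔
      ∃ y : coverSubring X q, (R.red y) 0 1 = 0 ∧ (R.red y) 1 0 = 0 ∧ X.ι (y : X.B) = m)

include hpres in
/-- `O_s ⊆ O₀'` (the presentation and injectivity of `ι`). -/
theorem mem_coverOrder_of_mem_Os {x : X.B} (hx : x ∈ Os) : x ∈ coverOrder X q := by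
  obtain ⟨y, -, -, hy⟩ := (hpres (X.ι x)).mp ⟨x, hx, rfl⟩
  have : x = y := (X.ι_injective hy).symm
  rw [this]; exact y.2

include hpres in
/-- elements of `O_s` have diagonal reduction. -/
theorem red_diag_of_mem_Os {x : X.B} (hx : x ∈ Os) (hx' : x ∈ coverOrder X q) :
    (R.red ⟨x, hx'⟩) 0 1 = 0 ∧ (R.red ⟨x, hx'⟩) 1 0 = 0 := by
  obtain ⟨y, h1, h2, hy⟩ := (hpres (X.ι x)).mp ⟨x, hx, rfl⟩
  have : (⟨x, hx'⟩ : coverSubring X q) = y := Subtype.ext (X.ι_injective hy).symm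
  rw [this]; exact ⟨h1, h2⟩

include hpres in
/-- `ι(O_s¹) ≤ ι(O₀'¹)`. -/
theorem normOneUnits_Os_le_coverUnits : normOneUnits X.ι hOs ≤ coverUnits X q := by
  rintro u ⟨⟨x, hx, hxu⟩, ⟨y, hy, hyu⟩, hdet⟩
  exact ⟨⟨x, mem_coverOrder_of_mem_Os R Os hpres hx, hxu⟩, ⟨y, mem_coverOrder_of_mem_Os R Os hpres hy, hyu⟩, hdet⟩

include hpres in
/-- `ι(O_s¹) ≤ Γ_{T_s}`. -/
theorem normOneUnits_Os_le_levelOf : normOneUnits X.ι hOs ≤ R.levelOf (torusSubgroup (splitGen q)) := by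
  rintro u ⟨⟨x, hx, hxu⟩, ⟨y, hy, hyu⟩, hdet⟩
  have hx' := mem_coverOrder_of_mem_Os R Os hpres hx
  have hu : u ∈ coverUnits X q := ⟨⟨x, hx', hxu⟩, ⟨y, mem_coverOrder_of_mem_Os R Os hpres hy, hyu⟩, hdet⟩
  refine (R.mem_levelOf_iff _).mpr ⟨hu, ?_⟩
  rw [mem_splitTorus_iff, CoverReduction.coe_redHom, unitLift_eq_of_ι_eq ⟨u, hu⟩ hx' hxu]
  exact red_diag_of_mem_Os R Os hpres hx hx'

include hpres in
/-- forms of level `Γ_{T_s}` are `ι(O_s¹)`-invariant. -/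
theorem slash_eq_of_mem_Os (F : CuspForm (R.levelOf (torusSubgroup (splitGen q))) 2) {u : GL (Fin 2) ℝ} (hu : u ∈ normOneUnits X.ι hOs) :
    ⇑F ∣[(2 : ℤ)] u = ⇑F :=
  SlashInvariantForm.slash_action_eqn F u (normOneUnits_Os_le_levelOf R Os hOs hpres hu)

/-- the witness `γ_i` of `c_i ∈ redHom(ι(O₀'¹))·T_s` (strong approximation: `mem_torusCoset_split`). -/
def wit (i : Quotient (X.heckeSetoid ℓ)) : coverUnits X q := Classical.choose (mem_torusCoset_split R hq (S.c R i))

omit [Fintype (Quotient (X.heckeSetoid ℓ))] in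
/-- `redHom(γ_i)⁻¹ c_i ∈ T_s`. -/
theorem wit_spec (i : Quotient (X.heckeSetoid ℓ)) : (R.redHom (S.wit R hq i))⁻¹ * S.c R i ∈ torusSubgroup (splitGen q) :=
  Classical.choose_spec (mem_torusCoset_split R hq (S.c R i))

/-- **`δ_i := γ_i⁻¹ α_i`** — the same double coset, re-represented inside `ι(O_s(ℓ))`. -/
def δ (i : Quotient (X.heckeSetoid ℓ)) : GL (Fin 2) ℝ := ((S.wit R hq i : coverUnits X q) : GL (Fin 2) ℝ)⁻¹ * S.α i

omit [Fintype (Quotient (X.heckeSetoid ℓ))] in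
/-- unfolding `δ`. -/
theorem δ_def (i : Quotient (X.heckeSetoid ℓ)) : S.δ R hq i = ((S.wit R hq i : coverUnits X q) : GL (Fin 2) ℝ)⁻¹ * S.α i := rfl

omit [Fintype (Quotient (X.heckeSetoid ℓ))] in
/-- `det δ_i = ℓ`. -/
theorem det_δ (i : Quotient (X.heckeSetoid ℓ)) : Matrix.det ((S.δ R hq i : GL (Fin 2) ℝ) : Matrix (Fin 2) (Fin 2) ℝ) = (ℓ : ℝ) := by
  have h1 : Matrix.det ((((S.wit R hq i : coverUnits X q) : GL (Fin 2) ℝ)⁻¹ : GL (Fin 2) ℝ) : Matrix (Fin 2) (Fin 2) ℝ) = 1 := by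
    rw [← Matrix.GeneralLinearGroup.val_det_apply, map_inv, (S.wit R hq i).2.2.2, inv_one, Units.val_one]
  rw [δ, Matrix.GeneralLinearGroup.coe_mul, Matrix.det_mul, S.det_α, h1, one_mul]

/-- the lift of `δ_i` to `O₀'`: `lift γ_i⁻¹ · x_i`. -/
def liftδ (i : Quotient (X.heckeSetoid ℓ)) : coverSubring X q := unitLift (S.wit R hq i)⁻¹ * S.lift i

omit [Fintype (Quotient (X.heckeSetoid ℓ))] in
/-- `ι(lift δ_i) = δ_i`. -/
theorem ι_liftδ (i : Quotient (X.heckeSetoid ℓ)) : X.ι (S.liftδ R hq i : X.B) = ((S.δ R hq i : GL (Fin 2) ℝ) : Matrix (Fin 2) (Fin 2) ℝ) := by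
  rw [liftδ, Subring.coe_mul, map_mul, ι_unitLift, S.ι_lift, δ, Matrix.GeneralLinearGroup.coe_mul, Subgroup.coe_inv]

omit [Fintype (Quotient (X.heckeSetoid ℓ))] in
/-- `red(lift δ_i) = redHom(γ_i)⁻¹ c_i`. -/
theorem red_liftδ (i : Quotient (X.heckeSetoid ℓ)) :
    R.red (S.liftδ R hq i) = (((R.redHom (S.wit R hq i))⁻¹ * S.c R i : GL (Fin 2) (ZMod q)) : Matrix (Fin 2) (Fin 2) (ZMod q)) := by
  rw [liftδ, map_mul, Units.val_mul, ← map_inv, CoverReduction.coe_redHom, coe_c]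

omit [Fintype (Quotient (X.heckeSetoid ℓ))] in
/-- `red(lift δ_i)` is DIAGONAL (`= redHom(γ_i)⁻¹ c_i ∈ T_s`). -/
theorem red_liftδ_diag (i : Quotient (X.heckeSetoid ℓ)) : (R.red (S.liftδ R hq i)) 0 1 = 0 ∧ (R.red (S.liftδ R hq i)) 1 0 = 0 := by
  rw [red_liftδ]; exact (mem_splitTorus_iff _).mp (S.wit_spec R hq i)

omit [Fintype (Quotient (X.heckeSetoid ℓ))] in
include hpres in
/-- K1: `δ_i ∈ ι(O_s(ℓ))`. -/
theorem δ_mem (i : Quotient (X.heckeSetoid ℓ)) : S.δ R hq i ∈ unitsHeckeSet X.ι (O := Os) ℓ :=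
  ⟨(hpres _).mpr ⟨S.liftδ R hq i, (S.red_liftδ_diag R hq i).1, (S.red_liftδ_diag R hq i).2, S.ι_liftδ R hq i⟩, S.det_δ R hq i⟩

omit [Fintype (Quotient (X.heckeSetoid ℓ))] in
include hpres in
/-- K2: the `δ_i` are pairwise `ι(O_s¹)`-inequivalent ((SIMREP) (i)). -/
theorem δ_inj {i j : Quotient (X.heckeSetoid ℓ)} {u : GL (Fin 2) ℝ} (hu : u ∈ normOneUnits X.ι hOs) (h : u * S.δ R hq i = S.δ R hq j) : i = j := by
  have hu' : u ∈ coverUnits X q := normOneUnits_Os_le_coverUnits R Os hOs hpres hu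
  have hmem : (S.wit R hq j : GL (Fin 2) ℝ) * u * ((S.wit R hq i : coverUnits X q) : GL (Fin 2) ℝ)⁻¹ ∈ coverUnits X q :=
    (coverUnits X q).mul_mem ((coverUnits X q).mul_mem (S.wit R hq j).2 hu') ((coverUnits X q).inv_mem (S.wit R hq i).2)
  have h2 : S.α j = (S.wit R hq j : GL (Fin 2) ℝ) * u * ((S.wit R hq i : coverUnits X q) : GL (Fin 2) ℝ)⁻¹ * S.α i := by
    have e := congrArg (fun z => ((S.wit R hq j : coverUnits X q) : GL (Fin 2) ℝ) * z) h
    simp only [δ, mul_inv_cancel_left] at e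
    rw [← e]; group
  exact (S.disj j i _ hmem h2).symm

omit [Fintype (Quotient (X.heckeSetoid ℓ))] in
include hpres in
/-- K3: the `δ_i` meet every `ι(O_s¹)`-coset of `ι(O_s(ℓ))` ((SIMREP) (iv) + diagonal reductions). -/
theorem δ_cover (a : GL (Fin 2) ℝ) (ha : a ∈ unitsHeckeSet X.ι (O := Os) ℓ) :
    ∃ i, ∃ u ∈ normOneUnits X.ι hOs, u * S.δ R hq i = a := by
  obtain ⟨⟨x, hx, hxa⟩, hdet⟩ := ha
  have hx' : x ∈ coverOrder X q := mem_coverOrder_of_mem_Os R Os hpres hx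
  have ha' : a ∈ Charext.InertHecke.unitsHeckeSet X.ι (O := coverOrder X q) ℓ := ⟨⟨x, hx', hxa⟩, hdet⟩
  obtain ⟨i, v, hv, hva⟩ := S.cover a ha'
  have hα : S.α i = v * a := hva.symm
  have hw : v⁻¹ * ((S.wit R hq i : coverUnits X q) : GL (Fin 2) ℝ) ∈ coverUnits X q :=
    (coverUnits X q).mul_mem ((coverUnits X q).inv_mem hv) (S.wit R hq i).2
  let w : coverUnits X q := ⟨_, hw⟩
  have hwval : (w : GL (Fin 2) ℝ) = v⁻¹ * ((S.wit R hq i : coverUnits X q) : GL (Fin 2) ℝ) := rfl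
  have hprod : (w : GL (Fin 2) ℝ) * S.δ R hq i = a := by rw [hwval, δ, hα]; group
  -- the lift `ya` of `a` with diagonal reduction
  obtain ⟨ya, hya1, hya2, hya⟩ := (hpres _).mp ⟨x, hx, hxa⟩
  have ht : (R.redHom (S.wit R hq i))⁻¹ * S.c R i ∈ torusSubgroup (splitGen q) := S.wit_spec R hq i
  have hlift : unitLift w * S.liftδ R hq i = ya := by
    apply Subtype.ext
    apply X.ι_injective
    rw [Subring.coe_mul, map_mul, ι_unitLift, S.ι_liftδ R hq, hya, ← Matrix.GeneralLinearGroup.coe_mul, hprod]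
  have hred : R.red (unitLift w) =
      R.red ya * ((((R.redHom (S.wit R hq i))⁻¹ * S.c R i)⁻¹ : GL (Fin 2) (ZMod q)) : Matrix (Fin 2) (Fin 2) (ZMod q)) := by
    have e := congrArg R.red hlift
    rw [map_mul, S.red_liftδ R hq] at e
    rw [← e, mul_assoc, ← Units.val_mul, mul_inv_cancel, Units.val_one, mul_one]
  have hdiag : (R.red (unitLift w)) 0 1 = 0 ∧ (R.red (unitLift w)) 1 0 = 0 := by
    have ht' := (mem_splitTorus_iff _).mp ((torusSubgroup (splitGen q)).inv_mem ht)
    rw [hred]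
    generalize ((((R.redHom (S.wit R hq i))⁻¹ * S.c R i)⁻¹ : GL (Fin 2) (ZMod q)) : Matrix (Fin 2) (Fin 2) (ZMod q)) = tM at ht' ⊢
    constructor <;> simp [Matrix.mul_apply, Fin.sum_univ_two, hya1, hya2, ht'.1, ht'.2]
  have hwT : R.redHom w ∈ torusSubgroup (splitGen q) := by
    rw [mem_splitTorus_iff, CoverReduction.coe_redHom]; exact hdiag
  have hwT' := (mem_splitTorus_iff _).mp ((torusSubgroup (splitGen q)).inv_mem hwT)
  rw [← map_inv, CoverReduction.coe_redHom] at hwT'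
  refine ⟨i, (w : GL (Fin 2) ℝ), ⟨(hpres _).mpr ⟨unitLift w, hdiag.1, hdiag.2, ι_unitLift _⟩,
    (hpres _).mpr ⟨unitLift w⁻¹, hwT'.1, hwT'.2, ?_⟩, hw.2.2⟩, hprod⟩
  rw [ι_unitLift, Subgroup.coe_inv]

/-- the comparison map `Γ∖ι(O(ℓ)) → ι(O_s¹)∖ι(O_s(ℓ))`, `i ↦ [δ_i]`. -/
def toUnitsQuot (i : Quotient (X.heckeSetoid ℓ)) : Quotient (unitsHeckeSetoid X.ι hOs ℓ) :=
  Quotient.mk _ ⟨S.δ R hq i, S.δ_mem R hq Os hpres i⟩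

omit [Fintype (Quotient (X.heckeSetoid ℓ))] in
include hpres in
/-- **the two coset spaces are in bijection** (K2 + K3). -/
theorem toUnitsQuot_bijective : Function.Bijective (S.toUnitsQuot R hq Os hOs hpres) := by
  constructor
  · intro i j h
    obtain ⟨u, hu, e⟩ := Quotient.exact h
    exact S.δ_inj R hq Os hOs hpres hu e
  · intro cq
    obtain ⟨i, u, hu, e⟩ := S.δ_cover R hq Os hOs hpres ((cq.out : unitsHeckeSet X.ι (O := Os) ℓ) : GL (Fin 2) ℝ) cq.out.2
    refine ⟨i, ?_⟩
    rw [← Quotient.out_eq cq]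
    exact Quotient.sound ⟨u, hu, e⟩

include hq hpres in
/-- **THE KEY IDENTITY (HF)(iii)♭**: `(𝒯♭ (dockTorus T_s F))(1) = T_ℓ^{O_s} F` — the SAME double coset read through `δ_i = γ_i⁻¹ α_i ∈ ι(O_s(ℓ))`. -/
theorem heckeFn_dockTorus_split_one (F : CuspForm (R.levelOf (torusSubgroup (splitGen q))) 2) :
    S.heckeFn R (R.dockTorus (torusSubgroup (splitGen q)) F) 1 = unitsHeckeFun X.ι hOs ℓ ⇑F := by
  rw [heckeFn_def]
  have hterm : ∀ i : Quotient (X.heckeSetoid ℓ),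
      ⇑((R.dockTorus (torusSubgroup (splitGen q)) F).1 (S.c R i * 1)) ∣[(2 : ℤ)] (S.α i) = ⇑F ∣[(2 : ℤ)] (S.δ R hq i) := by
    intro i
    have hw : (R.redHom (S.wit R hq i))⁻¹ * (S.c R i * 1) ∈ torusSubgroup (splitGen q) := by
      rw [mul_one]; exact S.wit_spec R hq i
    rw [R.dockTorus_apply_of_witness _ _ hw, coverRep_apply, coe_coverSlash, CoverReduction.coe_restrictLevel, ← SlashAction.slash_mul, δ_def]
  simp_rw [hterm]
  haveI : Finite (Quotient (unitsHeckeSetoid X.ι hOs ℓ)) :=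
    Finite.of_surjective _ (S.toUnitsQuot_bijective R hq Os hOs hpres).2
  letI : Fintype (Quotient (unitsHeckeSetoid X.ι hOs ℓ)) := Fintype.ofFinite _
  funext τ
  rw [Finset.sum_apply, unitsHeckeFun_apply, finsum_eq_sum_of_fintype]
  apply Fintype.sum_bijective _ (S.toUnitsQuot_bijective R hq Os hOs hpres)
  intro i
  obtain ⟨u, hu, e⟩ := Quotient.mk_out (s := unitsHeckeSetoid X.ι hOs ℓ)
    (⟨S.δ R hq i, S.δ_mem R hq Os hpres i⟩ : unitsHeckeSet X.ι (O := Os) ℓ)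
  dsimp only at e
  show (⇑F ∣[(2 : ℤ)] S.δ R hq i) τ =
    (⇑F ∣[(2 : ℤ)] (((Quotient.mk (unitsHeckeSetoid X.ι hOs ℓ) ⟨S.δ R hq i, S.δ_mem R hq Os hpres i⟩).out :
      unitsHeckeSet X.ι (O := Os) ℓ) : GL (Fin 2) ℝ)) τ
  conv_lhs => rw [← e, SlashAction.slash_mul, slash_eq_of_mem_Os R Os hOs hpres F hu]

include hq hpres in
/-- **(HF)(iii) DISCHARGED**: a form of split-Cartan level is a `T_ℓ^{O_s}`-eigenform with eigenvalue `a` iff its torus docking is a `𝒯♭`-eigenvector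
with eigenvalue `a`. -/
theorem heckeLin_dockTorus_split_iff (F : CuspForm (R.levelOf (torusSubgroup (splitGen q))) 2) (a : ℂ) :
    (unitsHeckeFun X.ι hOs ℓ (⇑F) = fun τ => a * F τ) ↔
      S.heckeLin R (R.dockTorus (torusSubgroup (splitGen q)) F) = a • coeLin R (R.dockTorus (torusSubgroup (splitGen q)) F) := by
  constructor
  · intro hF
    apply S.heckeLin_dockTorus_of_one R
    · rw [S.heckeFn_dockTorus_split_one R hq Os hOs hpres, hF]; rfl
    · intro gb hgb; exact absurd (mem_torusCoset_split R hq gb) hgb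
  · intro h
    have h1 := congr_fun h 1
    rw [heckeLin_apply, S.heckeFn_dockTorus_split_one R hq Os hOs hpres, Pi.smul_apply, coeLin_apply, R.dockTorus_apply_one,
      CoverReduction.coe_restrictLevel] at h1
    rw [h1]; rfl

end Split

end SimRep

end HeckeCut

end Summit.BirchSwinnertonDyer.BirchSwinnertonDyer.Theorems.CartanDoubleCoset

end
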